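import Summits.Ventures.HodgeRepro2.T6N3DatumRich

/-!
# T6N3SideRichToy — the joint toy of the rich N3 carrier (§10.5(ii)(c)/(d) for STAGE 0)

Cell pub-hodge-repro2, Tier 6 (README §10), seat t6-p3 (N3 owner). FILED in WAVE 1 (p438126, row 3d-3;
beside T6N3SideRich / T6N3DatumRich, route/T6-N3-t6-p3.md v0.27 / v0.28 / v0.30 / v0.34); proof lane;
count-neutral; v2 = a DOCSTRING-ONLY successor version (this header sentence only; kernel content
unchanged; count NONE). The referees' non-vacuity
protocol asks that the carriers be inhabited and that the hypotheses instantiate simultaneously on a toy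
instance. Here, T6N3Toy's toy on the RICH carrier: `sideRich : N3SideRich ℂ Unit` with `L²([H]) = ℂ`,
trivial groups, `Sa = Sb = ℂ` (so `S = ℂ ⊗[ℂ] ℂ`), the bounded lift `K_ψ := φ_a φ_b \overline{ψ}` valued in
`C([H]) = ⊤` (so `Θ`, DERIVED by the Riesz representation, is `Θ(f, φ) = φ_a φ_b \overline{f}` — the
T6N3Toy lift), `π₀ = σ = ⊤`, `m₀ = 1` with the one-copy embedding `x ↦ x 0`, `P_χ = id`,
`F φ_a φ_b := φ_a φ_b`; `toyRich : N3DatumRich` = both sides `sideRich`. On `toyRich.toDatum` the sixteen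
remaining per-side interface Props of `N3A_of_datumRich` hold (the four discharged ones hold by
construction, `N3SideRich.toSide_*`), `hypI` / `hypII` hold, `ellNonzero` holds on both sides, and the
three rich N3 statements apply (`toyRich_N3A`, `toyRich_N3iso`). Nothing here is consumed by any theorem
of record: it is the kernel witness that the binder set of T6N3DatumRich is jointly satisfiable.

§8(d): uses an L-value-free non-vanishing device: NO.
-/

namespace Summit.Ventures.HodgeRepro2.T6.N3RichToy

open scoped InnerProductSpace TensorProduct
open Summit.Ventures.HodgeRepro2.T6

/-- The bounded conjugate-linear map `ψ ↦ \overline{ψ}` on `ℂ`, valued in `C([H]) = ⊤`. -/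
noncomputable def conjTop : ℂ →L⋆[ℂ] ↥(⊤ : Submodule ℂ ℂ) :=
  LinearMap.mkContinuous
    { toFun := fun ψ => ⟨(starRingEnd ℂ) ψ, Submodule.mem_top⟩
      map_add' := fun a b => by ext; simp
      map_smul' := fun c a => by ext; simp }
    1 (fun ψ => by simp)

/-- `(conjTop ψ : ℂ) = \overline{ψ}`. -/
@[simp] lemma coe_conjTop_apply (ψ : ℂ) : (conjTop ψ : ℂ) = (starRingEnd ℂ) ψ := rfl

/-- The toy lift on the doubled data `ℂ ⊗[ℂ] ℂ`: `K_ψ(φ_a ⊗ φ_b) := φ_a φ_b \overline{ψ}`, linear in the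
datum through `TensorProduct.lid`. -/
noncomputable def kliftToy : (ℂ ⊗[ℂ] ℂ) →ₗ[ℂ] (ℂ →L⋆[ℂ] ↥(⊤ : Submodule ℂ ℂ)) :=
  LinearMap.smulRight (TensorProduct.lid ℂ ℂ).toLinearMap conjTop

/-- `kliftToy (a ⊗ₜ b) ψ = a b \overline{ψ}`. -/
lemma coe_kliftToy_tmul (a b ψ : ℂ) : (kliftToy (a ⊗ₜ b) ψ : ℂ) = a * b * (starRingEnd ℂ) ψ := by
  simp [kliftToy, smul_eq_mul, mul_assoc]

/-- The one-copy isotypic embedding `x ↦ x 0` of the `ℓ²`-product of one copy of `⊤` into `ℂ`. -/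
noncomputable def iotaToy : PiLp 2 (fun _ : Fin 1 => ↥(⊤ : Submodule ℂ ℂ)) →ₗᵢ[ℂ] ℂ where
  toFun x := (x 0 : ℂ)
  map_add' x y := by simp
  map_smul' c x := by simp
  norm_map' x := by
    rw [PiLp.norm_eq_of_L2, Fin.sum_univ_one, Real.sqrt_sq (norm_nonneg _)]
    rfl

/-- `iotaToy x = x 0`. -/
@[simp] lemma iotaToy_apply (x : PiLp 2 (fun _ : Fin 1 => ↥(⊤ : Submodule ℂ ℂ))) :
    iotaToy x = (x 0 : ℂ) := rfl

/-- THE TOY RICH SIDE: everything is `ℂ`, the groups are trivial, one copy. -/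
noncomputable abbrev sideRich : N3SideRich ℂ Unit where
  LH := ℂ
  Hf := Unit
  R _ := LinearIsometry.id
  K := ⊤
  Sa := ℂ
  Sb := ℂ
  ωH _ := LinearMap.id
  ωGa _ := LinearMap.id
  ωGb _ := LinearMap.id
  Cont := ⊤
  Klift := kliftToy
  σ := ⊤
  π₀ := ⊤
  m₀ := 1
  ι := iotaToy
  τ'iso := ⊤
  Ptor := (⊤ : Submodule ℂ ℂ).subtype
  F := LinearMap.mul ℂ ℂ

/-- THE TOY RICH DATUM: `L²([G]) = ℂ`, the trivial group, one automorphic representation, both sides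
`sideRich`. -/
noncomputable abbrev toyRich : N3DatumRich where
  LG := ℂ
  Gf := Unit
  ρ _ := LinearIsometry.id
  τiso := ⊤
  Aut := Unit
  aut _ := ⊤
  A := sideRich
  B := sideRich

/-- The toy side of record: `sideRich.toSide`. -/
noncomputable abbrev side : N3Side ℂ Unit := sideRich.toSide

/-- The toy datum of record: `toyRich.toDatum`. -/
noncomputable abbrev toy : N3Datum := toyRich.toDatum

/-- Every copy of the toy is the identity (`Fin 1`). -/
lemma copy_apply (j : Fin 1) (v : ↥(⊤ : Submodule ℂ ℂ)) : (side.copy j v : ℂ) = v := by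
  obtain rfl := Subsingleton.elim j 0
  show (iotaToy (PiLp.single 2 0 v) : ℂ) = v
  rw [iotaToy_apply, PiLp.single_eq_same]

/-- `Kfix = ⊤` on the toy. -/
lemma side_Kfix : side.Kfix = ⊤ :=
  eq_top_iff.mpr fun _ _ _ _ => rfl

/-- `SKfix = ⊤` on the toy. -/
lemma side_SKfix : side.SKfix = ⊤ :=
  eq_top_iff.mpr fun _ _ _ _ => rfl

/-- `isotypic = ⊤` on the toy. -/
lemma side_isotypic : side.isotypic = ⊤ := by
  refine eq_top_iff.mpr fun x _ => ?_
  refine Submodule.mem_iSup_of_mem (0 : Fin 1) ?_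
  exact ⟨⟨x, Submodule.mem_top⟩, copy_apply 0 ⟨x, Submodule.mem_top⟩⟩

/-- `levelPart = ⊤` on the toy. -/
lemma side_levelPart : side.levelPart = ⊤ := by
  rw [N3Side.levelPart, side_isotypic, side_Kfix]
  show ⊤ ⊓ ⊤ ⊓ (⊤ : Submodule ℂ ℂ) = ⊤
  simp

/-- `Θ φ f` on the toy, on pure tensors: `⟪Θ (a ⊗ b) f, ψ⟫ = \overline{a b} ψ f`. -/
lemma inner_theta_tmul (a b f ψ : ℂ) :
    ⟪side.Θ (a ⊗ₜ b) f, ψ⟫_ℂ = (starRingEnd ℂ) (a * b) * ψ * f := by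
  show ⟪thetaVec (sideRich.kliftL (a ⊗ₜ b)) f, ψ⟫_ℂ = _
  rw [inner_thetaVec_left, N3SideRich.kliftL_apply, coe_kliftToy_tmul, RCLike.inner_apply]
  simp only [map_mul, starRingEnd_self_apply]
  ring

/-- Hypothesis (i) on the toy: `f = 1`, `φ = 1 ⊗ 1`, `⟪Θ(1 ⊗ 1) 1, 1⟫ = 1 ≠ 0`. -/
lemma toy_hypI : side.hypI :=
  ⟨1, ⟨Submodule.mem_top, Submodule.mem_top⟩, (1 : ℂ) ⊗ₜ (1 : ℂ), fun h => by
    have := inner_theta_tmul 1 1 1 1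
    rw [h, inner_zero_left] at this
    simp at this⟩

/-- Hypothesis (ii) on the toy: `k = 1 ∈ Π(π₀)^{K,τ′}`, `P_χ(1) = 1 ≠ 0`. -/
lemma toy_hypII : side.hypII :=
  ⟨⟨1, Submodule.mem_top⟩, by rw [side_levelPart]; exact Submodule.mem_top, one_ne_zero⟩

/-- The seam on the toy: `ℓ(φ_a, φ_b)(ψ) = P_χ(K_ψ)` with `K_ψ = φ_a φ_b \overline{ψ}`. -/
lemma toy_Seam : side.Seam sideRich.toSide_kliftCont := by
  intro φa φb ψ
  show ⟪ψ, φa * φb⟫_ℂ = (kliftToy (φa ⊗ₜ φb) ψ : ℂ)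
  rw [coe_kliftToy_tmul, RCLike.inner_apply, mul_comm]

/-- `KliftLevel` on the toy. -/
lemma toy_KliftLevel : side.KliftLevel := fun _ _ _ => ⟨by rw [side_Kfix]; trivial, Submodule.mem_top⟩

/-- `KliftIsotypic` on the toy. -/
lemma toy_KliftIsotypic : side.KliftIsotypic := fun _ _ _ _ => by
  rw [side_isotypic]; trivial

/-- `ThetaMemSigma` on the toy. -/
lemma toy_ThetaMemSigma : side.ThetaMemSigma := fun _ _ _ => Submodule.mem_top

/-- `ThetaTauType` on the toy. -/
lemma toy_ThetaTauType : side.ThetaTauType (⊤ : Submodule ℂ ℂ) := fun _ _ _ => Submodule.mem_top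

/-- `CopiesEquivariant` on the toy (trivial group, identity copies). -/
lemma toy_CopiesEquivariant : side.CopiesEquivariant := fun j _ v =>
  ⟨Submodule.mem_top, by rw [copy_apply, copy_apply]⟩

/-- `CopiesIncl` on the toy: the one copy is the inclusion. -/
lemma toy_CopiesIncl : side.CopiesIncl := ⟨0, fun v => copy_apply 0 v⟩

/-- `CopiesTauType` on the toy. -/
lemma toy_CopiesTauType : side.CopiesTauType := fun _ _ => by simp

/-- `TauTypeDecomposes` on the toy. -/
lemma toy_TauTypeDecomposes : side.TauTypeDecomposes := fun _ _ _ => Submodule.mem_top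

/-- `LevelPartFinite` on the toy. -/
lemma toy_LevelPartFinite : side.LevelPartFinite := by
  show FiniteDimensional ℂ side.levelPart
  rw [side_levelPart]
  infer_instance

/-- `LevelPartCont` on the toy. -/
lemma toy_LevelPartCont : side.LevelPartCont := fun _ _ => Submodule.mem_top

/-- `KAverage` on the toy. -/
lemma toy_KAverage : side.KAverage := fun φ => ⟨φ, by rw [side_SKfix]; trivial, fun _ _ => rfl⟩

/-- `ThetaEquivariant` on the toy (trivial group, trivial Weil action). -/
lemma toy_ThetaEquivariant : side.ThetaEquivariant := fun _ _ _ => rfl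

/-- `SpanOfFixedVector` on the toy. -/
lemma toy_SpanOfFixedVector : side.SpanOfFixedVector := by
  intro j u hu hu0 w _
  have hmem : u ∈ Submodule.span ℂ (Set.range fun g : Unit => side.R g u) :=
    Submodule.subset_span ⟨(), rfl⟩
  have : (w / u) • u = w := by
    rw [smul_eq_mul, div_mul_cancel₀ w hu0]
  rw [← this]
  exact Submodule.smul_mem _ _ hmem

/-- `CrossCopyOrthogonal` on the toy (one copy). -/
lemma toy_CrossCopyOrthogonal : side.CrossCopyOrthogonal :=
  fun i j hij => absurd (Subsingleton.elim i j) hij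

/-- `CopyIndependence` on the toy (one copy). -/
lemma toy_CopyIndependence : side.CopyIndependence := fun i j _ _ _ _ => by
  rw [Subsingleton.elim i j]

/-- (d) for side A: `ellNonzero` on the toy from the rich N3A statement (sixteen binders + (i), (ii)). -/
theorem toyRich_N3A : toy.ellNonzero toy.A :=
  toyRich.N3A_of_datumRich toy_Seam toy_KliftLevel toy_KliftIsotypic toy_ThetaMemSigma
    toy_ThetaTauType toy_CopiesEquivariant toy_CopiesIncl toy_CopiesTauType toy_TauTypeDecomposes
    toy_LevelPartFinite toy_LevelPartCont toy_KAverage toy_ThetaEquivariant toy_SpanOfFixedVector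
    toy_CrossCopyOrthogonal toy_CopyIndependence toy_hypI toy_hypII

/-- (d) for side B: the same side, the same proof. -/
theorem toyRich_N3B : toy.ellNonzero toy.B :=
  toyRich.N3B_of_datumRich toy_Seam toy_KliftLevel toy_KliftIsotypic toy_ThetaMemSigma
    toy_ThetaTauType toy_CopiesEquivariant toy_CopiesIncl toy_CopiesTauType toy_TauTypeDecomposes
    toy_LevelPartFinite toy_LevelPartCont toy_KAverage toy_ThetaEquivariant toy_SpanOfFixedVector
    toy_CrossCopyOrthogonal toy_CopyIndependence toy_hypI toy_hypII

/-- `ProductsIn20` on the toy. -/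
lemma toy_ProductsIn20 : toy.ProductsIn20 toy.A := fun _ _ => by
  show _ ∈ ⨆ i : Unit, (⊤ : Submodule ℂ ℂ) ⊓ ⊤
  exact Submodule.mem_iSup_of_mem () ⟨Submodule.mem_top, Submodule.mem_top⟩

/-- `ProductEquivariant` on the toy. -/
lemma toy_ProductEquivariant : toy.ProductEquivariant toy.A := fun _ _ _ => rfl

/-- `AutStable` on the toy. -/
lemma toy_AutStable : toy.AutStable := fun _ _ _ _ => ⟨Submodule.mem_top, Submodule.mem_top⟩

/-- `AutSimple` on the toy (`ℂ` is simple). -/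
lemma toy_AutSimple : toy.AutSimple := by
  intro i N _ _
  rcases eq_bot_or_eq_top N with h | h
  · exact Or.inl h
  · right
    rw [h]
    simp

/-- `AutNonIso` on the toy (one automorphic representation). -/
lemma toy_AutNonIso : toy.AutNonIso toy_AutStable := fun i j hij => absurd (Subsingleton.elim i j) hij

/-- `AutOrthogonal` on the toy. -/
lemma toy_AutOrthogonal : toy.AutOrthogonal := fun i j hij => absurd (Subsingleton.elim i j) hij

/-- `SigmaIsAut` on the toy. -/
lemma toy_SigmaIsAut : toy.SigmaIsAut toy.A := ⟨(), rfl⟩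

/-- (d) for the assembly on the rich toy: a single pair of products with a non-zero pairing. -/
theorem toyRich_N3iso : ∃ (φa : toy.A.Sa) (φb : toy.A.Sb) (φc : toy.B.Sa) (φd : toy.B.Sb),
    ⟪toy.B.F φc φd, toy.A.F φa φb⟫_ℂ ≠ 0 :=
  toyRich.N3iso_of_datumRich toy_AutOrthogonal toy_AutStable toy_AutSimple toy_AutNonIso
    toy_ProductsIn20 toy_ProductEquivariant toy_ProductsIn20 toy_ProductEquivariant toy_SigmaIsAut rfl
    toyRich_N3A toyRich_N3B

end Summit.Ventures.HodgeRepro2.T6.N3RichToy
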